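import Summits.ABC.IUTFork.Repair.RHReqsideWeightLawsSignPairsK3
import HarnessLib

/-!
# D-0122 AXIS B, knob k1 — THE TYPED FORM, part 3f: TIER L1 (exact slack) for every pilot law — the cell MARGIN, the EXACT DEFICIT `DD`, and the kept
# mass of record `K_L1 = M − DD`: `DD` is MONOTONE in the law and ANTITONE in the allowance, `DD = 0 ⟺ T = 0 ⟺` saturation, and `den·DD ≤ m·T`
# (i.e. `K_L1 ≥ K_L0`); worked place `DD_print = 2471121` (`μ_ex = 0.76921`)

abc-iut cell, rung LADDER-ABC:A2.RESCUE.H; seat abc-iut-reqb-typ-1 (GEN 3; D-0122 axis B typer k1/k4; R69 (A1) hardening queue); owner abc-iut-rh-lead g4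
(`plan/rescue/R-H/ROUND3/REQB-SPEC.md` v0.2 §6(a)(P2): «RATIO OF RECORD `ρ_mod := K_L1,mod/Req_mod` (supply = exact-slack kept mass, socket-L1 ceiling) with
STRICT twin `ρ⁰ := K_L0,mod/Req_mod`»; TOPT-LP-SPEC v1.2 §S2/§S3: tier L1 = (EX, none), `K_L1 = Σ_w (MM_w − DD_w)·u_w`, `DD_w = Σ_j (−margin_j)⁺`,
`margin_j = m_q − [e_w·⌊(f(j)m_q − den(j·D + (j+1)·R_in))/(den·e_w)⌋ + (j+1)·R_out]`); referee abc-iut-reqb-ref-1 (worked-place digits WP-GRID-ref-1-v1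
c1c60d110a62a744: print `DD 2471121 · mu_ex 0.76921`, `κ = 3`: `DD 420727617`). Parts 3a–3e = p516945 / p517864 / p519304 / p520175 / p520993 (this seat; tier
L0: `offDemand` = `T`, `keptDemand` = `K_L0`); gen 2's bed files p513467 / p514474 carried `MM`, `LL`, `DD` as engine integers per place type. Here the
exact tier is TYPED for a general law, so the ratio of record has a typed shape next to its strict twin. Nothing re-typed.
* §1 `margin f den e m δ r_in r_out j` (the engines' margin, any `den`), `cell_iff_margin_nonneg` (**`Cell ⟺ margin ≥ 0`**, definitional), the EXACT DEFICIT
  `exactDeficit … L := Σ_{j ≤ L} (−margin_j)⁺` (`= DD_w`; `K_L1(w) = (M(w)·den − DD_w·…)` see §3), `exactDeficit_nonneg`, **`exactDeficit_eq_zero_iff`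
  (`DD = 0 ⟺` every label licensed `⟺ T = 0`** for the strict laws, part 3a `offDemand_eq_zero_iff_forall_cell`).
* §2 SIGNS AT TIER L1: `margin_anti_law` (cross-denominator: `f/den ≤ g/den′`, `m ≥ 0` ⟹ `margin_g ≤ margin_f`), **`exactDeficit_mono_law` (`DD_f ≤ DD_g`:
  the exact deficit is MONOTONE in the pilot law)**, `margin_mono_shell` / **`exactDeficit_anti_shell`** (a looser allowance lowers `DD` under every law),
  the κ-chain `exactDeficit_lawPow_mono`. CAVEAT as at tier L0: `K_L1 = M − DD` has BOTH terms decreasing under a lighter law, so the ratio word `ρ` itself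
  stays the engines' (A ≡ B); the signs of `M`, `T`, `DD` separately are theorems.
* §3 **`den·(−margin_j)⁺ ≤ (f(j) − den)·m`** at every label with `f(j) ≥ den` (`δ ≥ 0`, `r_out ≤ r_in`, `m ≥ 0`: the deficit never exceeds the demand, since
  the price `j·δ + (j+1)·G ≥ 0`), hence **`den·DD ≤ m·T`** (`den_mul_exactDeficit_le`) — in mass units `DD·u ≤ T`, i.e. **`K_L1 ≥ K_L0`**: the tier of record
  keeps at least what the strict twin keeps, for every law (REQB (P2) `ρ ≥ ρ⁰`).
* §4 WORKED PLACE FREY `p = 7`, `l = 107`: `DD_print = 2471121` by `decide` over the 53 labels (= referee WP-GRID; `μ_ex = (10707060 − 2471121)/10707060 =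
  0.76921`), `DD_{κ=1} = DD_{κ=3/2} = 0` (saturation, no evaluation), and `DD_{κ=5/2}, DD_{κ=3} ≥ 2471121` by the chain.
HONEST FRAMING: integer arithmetic about OUR typed cell with a free pilot law (a PARAMETER — REQB-SPEC FRAMING; CONSISTENCY = abc-iut-reqb-rf-1's column);
the netting tiers (L0a/b, L1a/b) and the cone price are NOT typed here; nothing here asserts that abc is proved or refuted, or that [IUTchIII] Cor. 3.12 /
[IUTchIV] Thm. 1.10 holds or fails at any datum, or takes a side on any author; typed ≠ proved; computed ≠ proved.
[claim: Mochizuki2012, status: disputed] for every IUT locution. [cite: Mochizuki2012, IUTchIII Cor. 3.12 p. 173–174; IUTchIV Prop. 1.2 p. 10, Prop. 1.4 p. 13]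
-/

noncomputable section

open Finset

namespace Summit.ABC.IUTFork.Repair.RH.ReqsideWeightLaws

/-! ## §1. The margin and the exact deficit -/

/-- **THE CELL MARGIN** under the law `f/den` at label `j`: `margin := m − (j+1)·r_out − e·⌊(f(j)·m − den·(j·δ + (j+1)·r_in))/(den·e)⌋` — the engines'
`margin_j` (TOPT-LP-SPEC §S2; `≥ 0` iff licensed). [claim: Mochizuki2012, status: disputed] -/
@[claim "Mochizuki2012" "disputed"]
def margin (f : ℕ → ℤ) (den e m δ rin rout : ℤ) (j : ℕ) : ℤ :=
  m - ((j : ℤ) + 1) * rout - e * ((f j * m - den * ((j : ℤ) * δ + ((j : ℤ) + 1) * rin)) / (den * e))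

/-- **`Cell ⟺ margin ≥ 0`** (definitional). [folklore] -/
theorem cell_iff_margin_nonneg (f : ℕ → ℤ) (den e m δ rin rout : ℤ) (j : ℕ) :
    Cell f den e m δ rin rout j ↔ 0 ≤ margin f den e m δ rin rout j := by
  unfold Cell margin
  constructor <;> intro h <;> linarith

/-- **THE EXACT DEFICIT `DD_w := Σ_{1 ≤ j ≤ L} (−margin_j)⁺`** of the place under the law `f/den` (tier L1 = exact information, no netting:
`K_L1(w) = M(w) − DD_w·u_w` in the engines' mass units). [claim: Mochizuki2012, status: disputed] -/
@[claim "Mochizuki2012" "disputed"]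
def exactDeficit (f : ℕ → ℤ) (den e m δ rin rout : ℤ) (L : ℕ) : ℤ :=
  ∑ i ∈ Finset.range L, max 0 (-(margin f den e m δ rin rout (i + 1)))

/-- `DD ≥ 0`. [folklore] -/
theorem exactDeficit_nonneg (f : ℕ → ℤ) (den e m δ rin rout : ℤ) (L : ℕ) : 0 ≤ exactDeficit f den e m δ rin rout L :=
  Finset.sum_nonneg fun _ _ => le_max_left _ _

/-- **`DD = 0 ⟺ EVERY LABEL `1 … L` IS LICENSED`** (each summand `(−margin_j)⁺` vanishes iff `margin_j ≥ 0`). [folklore] -/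
theorem exactDeficit_eq_zero_iff (f : ℕ → ℤ) (den e m δ rin rout : ℤ) (L : ℕ) :
    exactDeficit f den e m δ rin rout L = 0 ↔ ∀ j, 1 ≤ j → j ≤ L → Cell f den e m δ rin rout j := by
  unfold exactDeficit
  rw [Finset.sum_eq_zero_iff_of_nonneg (fun i _ => le_max_left _ _)]
  constructor
  · intro h j hj hjL
    obtain ⟨i, rfl⟩ : ∃ i, j = i + 1 := ⟨j - 1, by omega⟩
    have hi := max_eq_left_iff.mp (h i (Finset.mem_range.mpr (by omega)))
    rw [cell_iff_margin_nonneg]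
    linarith
  · intro h i hi
    rw [Finset.mem_range] at hi
    have hc := (cell_iff_margin_nonneg f den e m δ rin rout (i + 1)).mp (h (i + 1) (Nat.succ_pos i) (by omega))
    exact max_eq_left (by linarith)

/-- **`DD = 0 ⟺ T = 0`** for a strict law (`f(1) = den`, `f(j) > den` for `j ≥ 2`; `δ ≥ 0`, `r_out ≤ r_in`): the exact tier and the licence tier VANISH together,
exactly at saturation (part 3a `offDemand_eq_zero_iff_forall_cell`). [folklore] -/
theorem exactDeficit_eq_zero_iff_offDemand_eq_zero {f : ℕ → ℤ} {den e m δ rin rout : ℤ} (hden : 0 < den) (he : 0 < e) (hf1 : f 1 = den)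
    (hf : ∀ j, 2 ≤ j → den < f j) (hδ : 0 ≤ δ) (hG : rout ≤ rin) (L : ℕ) :
    exactDeficit f den e m δ rin rout L = 0 ↔ offDemand f den e m δ rin rout L = 0 := by
  rw [exactDeficit_eq_zero_iff, offDemand_eq_zero_iff_forall_cell hden he hf1 hf hδ hG]

/-! ## §2. Signs at tier L1 -/

/-- **THE MARGIN IS ANTITONE IN THE PILOT LAW** (cross-denominator; `m ≥ 0`): `f(j)·den′ ≤ g(j)·den ⟹ margin_g ≤ margin_f` — the floor term grows with
the pilot order (the comparison of part 3a `cell_of_mul_le_of_cell`). [folklore] -/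
theorem margin_anti_law {f g : ℕ → ℤ} {den den' e m δ rin rout : ℤ} (hden : 0 < den) (hden' : 0 < den') (he : 0 < e) (hm : 0 ≤ m)
    {j : ℕ} (hfg : f j * den' ≤ g j * den) : margin g den' e m δ rin rout j ≤ margin f den e m δ rin rout j := by
  unfold margin
  set A : ℤ := (j : ℤ) * δ + ((j : ℤ) + 1) * rin with hA
  have h1 : (f j * m - den * A) / (den * e) = (den' * (f j * m - den * A)) / (den' * (den * e)) :=
    (Int.mul_ediv_mul_of_pos _ _ hden').symm
  have h2 : (g j * m - den' * A) / (den' * e) = (den * (g j * m - den' * A)) / (den * (den' * e)) :=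
    (Int.mul_ediv_mul_of_pos _ _ hden).symm
  have h3 : den' * (den * e) = den * (den' * e) := by ring
  have hle : den' * (f j * m - den * A) ≤ den * (g j * m - den' * A) := by
    nlinarith [mul_le_mul_of_nonneg_right hfg hm]
  have h4 : (f j * m - den * A) / (den * e) ≤ (g j * m - den' * A) / (den' * e) := by
    rw [h1, h2, h3]
    exact Int.ediv_le_ediv (mul_pos hden (mul_pos hden' he)) hle
  nlinarith [mul_le_mul_of_nonneg_left h4 he.le]

/-- **`DD` IS MONOTONE IN THE PILOT LAW** (cross-denominator): `f/den ≤ g/den′` on labels `≥ 1`, `m ≥ 0` ⟹ `DD_f ≤ DD_g`. [folklore] -/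
theorem exactDeficit_mono_law {f g : ℕ → ℤ} {den den' e m δ rin rout : ℤ} (hden : 0 < den) (hden' : 0 < den') (he : 0 < e) (hm : 0 ≤ m)
    (hfg : ∀ j, 1 ≤ j → f j * den' ≤ g j * den) (L : ℕ) :
    exactDeficit f den e m δ rin rout L ≤ exactDeficit g den' e m δ rin rout L :=
  Finset.sum_le_sum fun i _ => max_le_max le_rfl (neg_le_neg (margin_anti_law hden hden' he hm (hfg (i + 1) (Nat.succ_pos i))))

/-- **THE MARGIN IS MONOTONE IN THE ALLOWANCE** (`den > 0`, `e > 0`): `δ ≤ δ′`, `r_in ≤ r_in′`, `r_out′ ≤ r_out ⟹ margin ≤ margin′`. [folklore] -/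
theorem margin_mono_shell {f : ℕ → ℤ} {den e m δ δ' rin rin' rout rout' : ℤ} (hden : 0 < den) (he : 0 < e) {j : ℕ} (hδ : δ ≤ δ')
    (hi : rin ≤ rin') (ho : rout' ≤ rout) : margin f den e m δ rin rout j ≤ margin f den e m δ' rin' rout' j := by
  unfold margin
  have hj : (0 : ℤ) ≤ (j : ℤ) := Nat.cast_nonneg j
  have hle : f j * m - den * ((j : ℤ) * δ' + ((j : ℤ) + 1) * rin') ≤ f j * m - den * ((j : ℤ) * δ + ((j : ℤ) + 1) * rin) := by
    nlinarith [mul_le_mul_of_nonneg_left hδ hj, mul_le_mul_of_nonneg_left hi (by linarith : (0 : ℤ) ≤ (j : ℤ) + 1)]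
  have h4 := Int.ediv_le_ediv (mul_pos hden he) hle
  nlinarith [mul_le_mul_of_nonneg_left h4 he.le, mul_le_mul_of_nonneg_left ho (by linarith : (0 : ℤ) ≤ (j : ℤ) + 1)]

/-- **`DD` IS ANTITONE IN THE ALLOWANCE under every law**: a looser shell lowers the exact deficit. [folklore] -/
theorem exactDeficit_anti_shell {f : ℕ → ℤ} {den e m δ δ' rin rin' rout rout' : ℤ} (hden : 0 < den) (he : 0 < e) (hδ : δ ≤ δ')
    (hi : rin ≤ rin') (ho : rout' ≤ rout) (L : ℕ) :
    exactDeficit f den e m δ' rin' rout' L ≤ exactDeficit f den e m δ rin rout L :=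
  Finset.sum_le_sum fun _ _ => max_le_max le_rfl (neg_le_neg (margin_mono_shell hden he hδ hi ho))

/-- The κ-chain at tier L1: `a ≤ b ⟹ DD_{lawPow a} ≤ DD_{lawPow b}` (`e > 0`, `m ≥ 0`); so `DD(1) ≤ DD(3/2) ≤ DD(2) ≤ DD(5/2) ≤ DD(3)`. [folklore] -/
theorem exactDeficit_lawPow_mono {a b : ℕ} (hab : a ≤ b) {e m : ℤ} (he : 0 < e) (hm : 0 ≤ m) (δ rin rout : ℤ) (L : ℕ) :
    exactDeficit (lawPow a) 1 e m δ rin rout L ≤ exactDeficit (lawPow b) 1 e m δ rin rout L :=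
  exactDeficit_mono_law one_pos one_pos he hm (fun _ hj => by simpa using lawPow_mono_exp hj hab) L

/-! ## §3. The deficit never exceeds the demand: `K_L1 ≥ K_L0` -/

/-- **`den·(−margin_j)⁺ ≤ (f(j) − den)·m`** (`den > 0`, `e > 0`, `m ≥ 0`, `δ ≥ 0`, `r_out ≤ r_in`, `f(j) ≥ den`): since `den·e·⌊X/(den·e)⌋ ≤ X`, the margin is
at least `price − demand` with price `j·δ + (j+1)·G ≥ 0`. [folklore] -/
theorem den_mul_deficit_le {f : ℕ → ℤ} {den e m δ rin rout : ℤ} (hden : 0 < den) (he : 0 < e) (hm : 0 ≤ m) (hδ : 0 ≤ δ) (hG : rout ≤ rin)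
    {j : ℕ} (hfj : den ≤ f j) : den * max 0 (-(margin f den e m δ rin rout j)) ≤ (f j - den) * m := by
  have hq := Int.ediv_mul_le (f j * m - den * ((j : ℤ) * δ + ((j : ℤ) + 1) * rin)) (mul_pos hden he).ne'
  have hj : (0 : ℤ) ≤ (j : ℤ) := Nat.cast_nonneg j
  have hdm : 0 ≤ (f j - den) * m := mul_nonneg (by linarith) hm
  rcases le_or_gt 0 (margin f den e m δ rin rout j) with h | h
  · rw [max_eq_left (by linarith), mul_zero]; exact hdm
  · rw [max_eq_right (by linarith)]
    unfold margin at h ⊢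
    nlinarith [mul_nonneg hj hδ, mul_nonneg (by linarith : (0 : ℤ) ≤ (j : ℤ) + 1) (by linarith : (0 : ℤ) ≤ rin - rout)]

open Classical in
/-- **`den·DD ≤ m·T`** (label units; `f ≥ den` on labels `≥ 1`): licensed labels have no deficit, unlicensed ones at most their demand — in mass units
`DD_w·u_w ≤ T(w)`, i.e. **`K_L1(w) = M(w) − DD_w·u_w ≥ M(w) − T(w) = K_L0(w)`**: the tier of record keeps at least the strict twin's mass, under every law
(REQB (P2) `ρ ≥ ρ⁰`). [folklore] -/
theorem den_mul_exactDeficit_le {f : ℕ → ℤ} {den e m δ rin rout : ℤ} (hden : 0 < den) (he : 0 < e) (hm : 0 ≤ m) (hδ : 0 ≤ δ) (hG : rout ≤ rin)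
    (hf : ∀ j, 1 ≤ j → den ≤ f j) (L : ℕ) :
    den * exactDeficit f den e m δ rin rout L ≤ m * offDemand f den e m δ rin rout L := by
  unfold exactDeficit offDemand
  rw [Finset.mul_sum, Finset.mul_sum]
  refine Finset.sum_le_sum fun i _ => ?_
  by_cases hc : Cell f den e m δ rin rout (i + 1)
  · have h0 : 0 ≤ margin f den e m δ rin rout (i + 1) := (cell_iff_margin_nonneg f den e m δ rin rout (i + 1)).mp hc
    rw [if_pos hc, max_eq_left (by linarith), mul_zero, mul_zero]
  · rw [if_neg hc, mul_comm m]
    exact den_mul_deficit_le hden he hm hδ hG (hf (i + 1) (Nat.succ_pos i))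

/-! ## §4. The worked place FREY `p = 7`, `l = 107` -/

/-- `DD` AT THE WORKED PLACE (`e 1605, m 210, δ 1604, r_in 268, r_out −4472, L = 53`): print `DD = 2471121` (referee WP-GRID `DD 2471121`, `mu_ex 0.76921 =
(10707060 − 2471121)/10707060`), by `decide` over the 53 labels; `κ = 1` and `κ = 3/2`: `DD = 0` (every label licensed; part 1, no evaluation); `κ = 5/2`, `κ = 3`:
`DD ≥ 2471121` by the chain. [folklore] -/
theorem worked_exactDeficit :
    exactDeficit (fun j => (j : ℤ) ^ 2) 1 1605 210 1604 268 (-4472) 53 = 2471121 ∧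
      exactDeficit (fun j => (j : ℤ)) 1 1605 210 1604 268 (-4472) 53 = 0 ∧
        exactDeficit (lawPow 3) 1 1605 210 1604 268 (-4472) 53 = 0 ∧
          2471121 ≤ exactDeficit (lawPow 5) 1 1605 210 1604 268 (-4472) 53 ∧
            2471121 ≤ exactDeficit (lawPow 6) 1 1605 210 1604 268 (-4472) 53 := by
  have hP : exactDeficit (fun j => (j : ℤ) ^ 2) 1 1605 210 1604 268 (-4472) 53 = 2471121 := by
    unfold exactDeficit margin
    decide
  have hP4 : exactDeficit (lawPow 4) 1 1605 210 1604 268 (-4472) 53 = 2471121 := by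
    rw [← hP]
    unfold exactDeficit margin
    refine Finset.sum_congr rfl fun i _ => ?_
    rw [lawPow_four]
  refine ⟨hP, ?_, ?_, ?_, ?_⟩
  · exact (exactDeficit_eq_zero_iff _ _ _ _ _ _ _ _).2 fun j hj _ => worked_kappaOne_all hj
  · exact (exactDeficit_eq_zero_iff _ _ _ _ _ _ _ _).2 fun j hj hjL => worked_kappaThreeHalves_all hj hjL
  · rw [← hP4]; exact exactDeficit_lawPow_mono (by norm_num) (by norm_num) (by norm_num) 1604 268 (-4472) 53
  · rw [← hP4]; exact exactDeficit_lawPow_mono (by norm_num) (by norm_num) (by norm_num) 1604 268 (-4472) 53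

end Summit.ABC.IUTFork.Repair.RH.ReqsideWeightLaws

end
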